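import Mathlib
import Literature.NumberTheory.ComplexMultiplication.ReflexCMTypeOrientation
import Literature.NumberTheory.ComplexMultiplication.ReflexNorm
import Literature.NumberTheory.Automorphic.ConjugateSelfDualCharacters
import Literature.NumberTheory.Automorphic.Liu2021.Def45AsPrinted
import HarnessLib

/-!
# [Liu 2021] Definition 4.5 (1) EVALUATED at a toy CM datum: `E = ℚ(ζ₉)`, `Φ_μ = {σ₁, σ₂, σ₄}` ⟹ `M'_μ = E` and `η'_μ(ζ₉) = ζ₉⁴`

Y. Liu, *Fourier–Jacobi cycles and arithmetic relative trace formula*, Camb. J. Math. **9** (2021) = arXiv:2102.11518 [Liu2021], TeX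
source `FJcycle.tex` §4.1; G. Shimura, *Abelian Varieties with Complex Multiplication and Modular Functions*, Princeton 1998 [Shimura1998],
§8.4 Example (1) (p. 85), §18.5 (18.5b)–(18.5c) (pp. 162–163).

PURPOSE (pub-hodgecm2 red team, `hodge-director/TGTBT.md` DELTA 13, D13.3 item 5, verbatim): «η-convention bet (g), NOW BINARY (row 69): the
tree needs ONE kernel witness that `Def45.eta (AlgHom.id ℚ F) ι₁ …` evaluates as Liu's l. 1939–1942 η_μ at a toy CM datum through ι₁ (e.g. ℚ(ζ₉)
…) — p308157 gives the reflex ORIENTATION side, p308086 the incompatibility; the VALUE-side identification against the printed formula is still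
a reading.»  This file supplies the VALUE side in the kernel, at `E = L = ℚ(ζ₉)` (`Gal ≅ (ℤ/9)ˣ`, exponent `a(g)`, `g ζ₉ = ζ₉^{a(g)}`, Mathlib's
`IsPrimitiveRoot.autToPow`), base point `φ = AlgHom.id`, ANY `ι : L →+* ℂ`, and the type `Φ ↔ a(g) ∈ {1,2,4}` of p308157 (`exists_cmType_nine`).

AS PRINTED ([Liu2021] `FJcycle.tex`): Def. 4.3 (2), l. 1919 «`M'_μ ⊆ ℂ` the reflex field of `(E, Φ_μ)`, with the induced CM type `Ψ_μ`»;
Def. 4.5 (1), ll. 1939–1942 «We denote by `η'_μ : Res_{M'_μ/ℚ} 𝔾_m → Res_{E/ℚ} 𝔾_m` the reciprocity map, and put `η_μ := η'_μ ∘ Nm_{M_μ/M'_μ}`»;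
proof of Prop. 4.6 (1), ll. 1976–1979 «[Shi71, (1.12) & (1.13)] for `(K′,Φ′) = (E, Φ_μ)`, `k = E′`, `(K,Φ) = (M′_μ, Ψ_μ)` … By Casselman's theorem
[Shi71, Theorem 6] we have `(A′, i′)` … the determinant of the action of `i′(x′)` on the `E′`-vector space `Lie_{E′}(A′)` is `η′_μ(x′)` for every
`x′ ∈ M′_μ`» — for an abelian variety of CM type `(M'_μ, Ψ_μ)` that determinant is the type norm `∏_{ψ ∈ Ψ_μ} ψ(x')`, so `η'_μ = N_{Ψ_μ}` valued
in the reflex field `E` of `(M'_μ, Ψ_μ)` (READING I1-R2 of `Def45AsPrinted`, p300837); Rem. 4.4, l. 1930 «`Ψ_{μ^c}` is the opposite CM type of `Ψ_μ`».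
[Shimura1998] §8.4 Example (1): «if `F` is abelian over `ℚ` and if `(F; {φ_i})` is primitive, the reflex of `(F; {φ_i})` is `(F; {φ_i⁻¹})`»
(`φ_a : ζ ↦ ζ^a`); §18.5 (18.5b) «`g(a) = ∏_{μ=1}^m a^{τ_μ}` (`a ∈ (K*)^×`)», (18.5c) «`g(a)g(a)^ρ = N_{K*/ℚ}(a)`».

WHAT THE KERNEL NOW SAYS AT THE DATUM (theorems only; `Φ ↔ {1,2,4}` is the hypothesis `hΦ`, p308157's shape):
1. `reflexField_nine_eq_top`: **`K*_μ = reflexField ℚ L (algValuedIn ι Φ) = ⊤`** (stabiliser of `{1,2,4}` in `(ℤ/9)ˣ` trivial — a `decide`;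
   `Gal ≃* (ℤ/9)ˣ`, Mathlib `IsCyclotomicExtension.autEquivPow`): Liu's `M'_μ = ι(E)`, the reflex field IS `E`, `η'_μ : E^× → E^×`.
2. `reflexNorm_nine_eq_prod`: for every `x ∈ K* = ℚ(ζ₉)`, **`reflexNorm(x) = ∏_{a(g) ∈ {1,5,7}} g(x) = σ₁(x)·σ₅(x)·σ₇(x)`** — (18.5b) over
   the reflex type `Ψ_μ = {σ₁,σ₅,σ₇} = {σ₁,σ₂,σ₄}⁻¹` (p308157 identified the SET `Ψ_μ`; this is its NORM); `reflexNormHom_zeta_nine`: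
   **`g(ζ₉) = ζ₉^{13} = ζ₉⁴`** in `K = E`; `finprod_reflexCMType_zeta_nine`: `∏_{τ ∈ Ψ_μ through ι} τ(ζ₉) = ι(ζ₉)⁴` in `ℂ`.
3. `etaPrime_zeta_nine`: **Def. 4.5 (1) as typed, `Def45.etaPrime (AlgHom.id ℚ L) ι hμ ⟨ζ₉, _⟩ = ζ₉ ^ 4`** for EVERY conjugate symplectic `μ` of `E`
   with `Φ_μ ↔ {1,2,4}` through `ι`; `eta_incl_zeta_nine`: **`η_μ(ζ₉) = ζ₉^{4·[M_μ:M'_μ]}`** (l. 1941); `det_cotangentMap_zeta_nine`: for any CM datum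
   `D_μ` (Def. 4.5 (2) — a HYPOTHESIS, its inhabitant is Prop. 4.6 (1), not in the tree) and `i_μ(ζ₉) = 1 ⊗ f`, **`det(f^* | 𝔪_e/𝔪_e²) = ζ₉^{4·[M_μ:M'_μ]}`**
   — the cotangent side of D11.3 item 5 as far as the tree has objects (`Def45.eta` is invariant under `ι ↦ conj ∘ ι`, p306543: same value through `conj ∘ ι`).
4. `exists_toyDatum_nine`: **THE DATUM EXISTS** — for every `ι` there IS a weight-one conjugate symplectic `μ` on `E = ℚ(ζ₉)` with `Φ_μ ↔ {1,2,4}`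
   (tree theorem `IdeleClassGroup.exists_isConjugateSymplectic_hasCMType`, [WeilBNT1967] VII §3), and for it `K*_μ = ⊤`, `η'_μ(ζ₉) = ζ₉⁴`.
5. DISCRIMINATION (`prod_rival_conventions_zeta_nine`, `zeta_pow_rival_pairwise_ne`, `reflexNormHom_bar_zeta_nine`, `complexConj_zeta_pow_four`):
   the type norms at `ζ₉` of the four candidates are `N_Φ = ζ₉⁷`, **`N_{Φ*} = ζ₉⁴` (the tree's `η'`)**, `N_Φ̄ = ζ₉²`, `N_{Φ̄*} = ζ₉⁵ = ρ(ζ₉⁴)` (the tree's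
   `η'` of `Φ̄ = Φ_{μ^c}`, Rem. 4.4), pairwise distinct: a VALUE slip between `η'_μ = N_{Ψ_μ}` and `N_{Φ_μ}`, `N_{Φ̄_μ}`, `η̄'_μ = η'_{μ^c}` is detected
   at this datum (contrast `ℚ(ζ₇)`, `{1,2,4}`: `S⁻¹ = S̄`, nothing separates).

WHAT REMAINS A READING: «reciprocity map» (l. 1939) `=` reflex type norm `N_{Ψ_μ}` — pinned by Liu's own l. 1979 and [Shi71, Thm 6] (READING
I1-R2, p300837; referee AUDIT v1.4 c1–c4); the kernel cannot read TeX.  GIVEN it, items 1–4 are the printed `η'_μ`, `η_μ`, `det(· | Lie)` at the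
datum, computed.  Nothing here inhabits `hdet45` at Liu's `A_μ`; 0 `def`, 0 named fact, axioms `[propext, Classical.choice, Quot.sound]`.
Mathlib: `IsCyclotomicExtension.autEquivPow`, `IsPrimitiveRoot.autToPow_spec/_injective/pow_inj`, `finprod_mem_image`, `Finset.prod_equiv`,
`IntermediateField.mem_fixedField_iff`, `Algebra.norm_algebraMap`, `decide` on `(ℤ/9)ˣ`.  Tree (nothing restated): `ReflexCMTypeOrientation` (p308157),
`ReflexNorm`, `ReflexType`/`ReflexPair`/`ReflexCMType`, `ConjugateSelfDualCharacters`, `Liu2021/Def45AsPrinted` (p300837).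

## References
* [Liu2021] Y. Liu, Camb. J. Math. 9 (2021) = arXiv:2102.11518 — Def. 4.3 (2) (l. 1919), Rem. 4.4 (l. 1930), Def. 4.5 (1)–(2) (ll. 1939–1950),
  proof of Prop. 4.6 (1) (ll. 1976–1979).
* [Shimura1998] G. Shimura, *Abelian Varieties with Complex Multiplication and Modular Functions*, Princeton Univ. Press 1998 — §8.3 Prop. 28–29,
  §8.4 Example (1) (p. 85), §18.5 (18.5b)–(18.5c).
* [WeilBNT1967] A. Weil, *Basic Number Theory*, Springer 1967 — Ch. VII §3 (via the tree theorem `exists_isConjugateSymplectic_hasCMType`).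

Provenance: pub-hodgecm2 TEAM hComp seat `hcomp-abcm-2` gen 4, 2026-08-21/22, answering `hodge-director/TGTBT.md` D13.3 item 5 on the reading
input of htheta-x2 g6 (pub-hodgecm2 `INBOX.md` 2026-08-21T23:00:22Z).  HC_CM is NOT proved; count-neutral.
-/

set_option autoImplicit false

noncomputable section

open scoped Pointwise
open NumberField NumberField.ComplexEmbedding
open Literature.AlgebraicGeometry.Motives (CMType AbelianVariety)
open Literature.NumberTheory.ComplexMultiplication

namespace Literature.NumberTheory.Automorphic.Liu2021

namespace Def45

section Nine

variable (L : Type) [Field L] [NumberField L] [IsCMField L] [IsGalois ℚ L] [IsCyclotomicExtension {9} ℚ L]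

/-- `Φ₉` is irreducible over `ℚ`. [folklore] -/
private theorem irreducible_cyclotomic_nine : Irreducible (Polynomial.cyclotomic 9 ℚ) :=
  Polynomial.cyclotomic.irreducible_rat (by norm_num)

omit [IsCMField L] [IsGalois ℚ L] in
/-- Mathlib's `autEquivPow : Gal(ℚ(ζ₉)/ℚ) ≃* (ℤ/9)ˣ` is `a = autToPow` on elements (`g ζ₉ = ζ₉^{a(g)}`). [folklore] -/
private theorem autEquivPow_eq (g : L ≃ₐ[ℚ] L) :
    IsCyclotomicExtension.autEquivPow L irreducible_cyclotomic_nine g =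
      (IsCyclotomicExtension.zeta_spec 9 ℚ L).autToPow ℚ g := rfl

omit [IsCMField L] [IsGalois ℚ L] in
/-- `a : Gal(ℚ(ζ₉)/ℚ) → (ℤ/9)ˣ` is surjective: `σ₅`, `σ₇`, … exist. [folklore] -/
private theorem autToPow_surjective :
    Function.Surjective ((IsCyclotomicExtension.zeta_spec 9 ℚ L).autToPow ℚ : (L ≃ₐ[ℚ] L) → (ZMod 9)ˣ) :=
  fun u => ⟨(IsCyclotomicExtension.autEquivPow L irreducible_cyclotomic_nine).symm u, by
    rw [← autEquivPow_eq, MulEquiv.apply_symm_apply]⟩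

omit [IsCMField L] [IsGalois ℚ L] in
/-- `a(g⁻¹) = a(g)⁻¹`. [folklore] -/
private theorem autToPow_symm' (g : L ≃ₐ[ℚ] L) :
    (IsCyclotomicExtension.zeta_spec 9 ℚ L).autToPow ℚ g.symm =
      ((IsCyclotomicExtension.zeta_spec 9 ℚ L).autToPow ℚ g)⁻¹ := by
  rw [← map_inv]
  rfl

omit [IsCMField L] [IsGalois ℚ L] in
/-- **`∏_{a(g) ∈ T} g(ζ₉) = ζ₉^{Σ_{u ∈ T} u}`** for any exponent set `T` (reindex along `a : Gal ≃ (ℤ/9)ˣ`, `g(ζ₉) = ζ₉^{a(g)}`). [folklore] -/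
private theorem prod_filter_autToPow_apply_zeta (T : Finset (ZMod 9)) :
    ∏ g ∈ Finset.univ.filter (fun g : L ≃ₐ[ℚ] L =>
        (((IsCyclotomicExtension.zeta_spec 9 ℚ L).autToPow ℚ g : (ZMod 9)ˣ) : ZMod 9) ∈ T),
      g (IsCyclotomicExtension.zeta 9 ℚ L) =
    IsCyclotomicExtension.zeta 9 ℚ L ^
      ∑ u ∈ Finset.univ.filter (fun u : (ZMod 9)ˣ => (u : ZMod 9) ∈ T), (u : ZMod 9).val := by
  rw [← Finset.prod_pow_eq_pow_sum]
  refine Finset.prod_equiv (IsCyclotomicExtension.autEquivPow L irreducible_cyclotomic_nine).toEquiv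
    (fun g => ?_) (fun g _ => ?_)
  · simp only [Finset.mem_filter, Finset.mem_univ, true_and, MulEquiv.toEquiv_eq_coe, MulEquiv.coe_toEquiv,
      autEquivPow_eq]
  · rw [MulEquiv.toEquiv_eq_coe, MulEquiv.coe_toEquiv, autEquivPow_eq]
    exact ((IsCyclotomicExtension.zeta_spec 9 ℚ L).autToPow_spec ℚ g).symm

omit [IsCMField L] [IsGalois ℚ L] [IsCyclotomicExtension {9} ℚ L] in
/-- `g ∈ S*(Φ_L, id) ↔ ι ∘ g⁻¹ ∈ Φ` (Shimura's `S* = {σ⁻¹ | σ ∈ S}` at base point `id`). [cite: Shimura1998, §8.3 Prop. 28] -/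
private theorem mem_reflexLift_id_iff (ι : L →+* ℂ) (Φ : CMType L) (g : L ≃ₐ[ℚ] L) :
    g ∈ (reflexLift (algValuedIn ι Φ.1) (AlgHom.id ℚ L) : Set (L ≃ₐ[ℚ] L)) ↔
      ι.comp (g.symm : L →+* L) ∈ Φ.1 := by
  rw [mem_reflexLift, mem_algValuedIn_iff]
  rfl

omit [IsCMField L] [IsGalois ℚ L] in
/-- **The reflex field of a type `Φ ↔ T` with trivial stabiliser (`hkey`: no `v ≠ 1` in `(ℤ/9)ˣ` with `v⁻¹ T = T`) is all of `ℚ(ζ₉)`**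
(«if `(F; {φ_i})` is primitive, the reflex of `(F; {φ_i})` is `(F; {φ_i⁻¹})`»). [cite: Shimura1998, §8.4 Example (1)] -/
theorem reflexField_eq_top_of_key (ι : L →+* ℂ) (Φ : CMType L) (T : Finset (ZMod 9))
    (hkey : ∀ v : (ZMod 9)ˣ, (∀ u : (ZMod 9)ˣ, (u : ZMod 9) ∈ T ↔ ((v⁻¹ * u : (ZMod 9)ˣ) : ZMod 9) ∈ T) → v = 1)
    (hΦ : ∀ g : L ≃ₐ[ℚ] L, ι.comp (g : L →+* L) ∈ Φ.1 ↔
      (((IsCyclotomicExtension.zeta_spec 9 ℚ L).autToPow ℚ g : (ZMod 9)ˣ) : ZMod 9) ∈ T) :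
    reflexField ℚ L (algValuedIn ι Φ.1) = ⊤ := by
  rw [eq_top_iff]
  intro x _
  rw [reflexField_eq_fixedField, IntermediateField.mem_fixedField_iff]
  intro g hg
  suffices hg1 : g = 1 by rw [hg1]; rfl
  rw [MulAction.mem_stabilizer_iff] at hg
  have hζ := IsCyclotomicExtension.zeta_spec 9 ℚ L
  have h1 : ∀ g' : L ≃ₐ[ℚ] L, ((hζ.autToPow ℚ g' : (ZMod 9)ˣ) : ZMod 9) ∈ T ↔
      (((hζ.autToPow ℚ g)⁻¹ * hζ.autToPow ℚ g' : (ZMod 9)ˣ) : ZMod 9) ∈ T := by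
    intro g'
    rw [← map_inv, ← map_mul, ← hΦ, ← hΦ]
    have h2 : (g' : L →ₐ[ℚ] L) ∈ algValuedIn ι Φ.1 ↔ (g' : L →ₐ[ℚ] L) ∈ g • algValuedIn ι Φ.1 := by rw [hg]
    rw [Set.mem_smul_set_iff_inv_smul_mem, mem_algValuedIn_iff, mem_algValuedIn_iff] at h2
    exact h2
  apply hζ.autToPow_injective ℚ
  rw [map_one]
  refine hkey _ fun u => ?_
  obtain ⟨g', rfl⟩ := autToPow_surjective L u
  exact h1 g'

omit [IsCMField L] [IsGalois ℚ L] in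
/-- **The reflex norm on elements, Galois side** ((18.5b) `g(a) = ∏ⱼ a^{ψⱼ}` over `{ψⱼ} = S*|_{K*}`): for a type `Φ ↔ T` of `ℚ(ζ₉)` with trivial
stabiliser and `T' = T⁻¹`, `reflexNorm(x) = ∏_{a(g) ∈ T'} g(x)` for every `x`. [cite: Shimura1998, §18.5 (18.5b)] [cite: Shimura1998, §8.4 Example (1)] -/
theorem reflexNorm_eq_prod_of_key (ι : L →+* ℂ) (Φ : CMType L) (T T' : Finset (ZMod 9))
    (hT' : ∀ u : (ZMod 9)ˣ, ((u⁻¹ : (ZMod 9)ˣ) : ZMod 9) ∈ T ↔ (u : ZMod 9) ∈ T')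
    (hkey : ∀ v : (ZMod 9)ˣ, (∀ u : (ZMod 9)ˣ, (u : ZMod 9) ∈ T ↔ ((v⁻¹ * u : (ZMod 9)ˣ) : ZMod 9) ∈ T) → v = 1)
    (hΦ : ∀ g : L ≃ₐ[ℚ] L, ι.comp (g : L →+* L) ∈ Φ.1 ↔
      (((IsCyclotomicExtension.zeta_spec 9 ℚ L).autToPow ℚ g : (ZMod 9)ˣ) : ZMod 9) ∈ T)
    (x : L) (hx : x ∈ reflexField ℚ L (algValuedIn ι Φ.1)) :
    reflexNorm ℚ L (algValuedIn ι Φ.1) (AlgHom.id ℚ L) ⟨x, hx⟩ =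
      ∏ g ∈ Finset.univ.filter (fun g : L ≃ₐ[ℚ] L =>
        (((IsCyclotomicExtension.zeta_spec 9 ℚ L).autToPow ℚ g : (ZMod 9)ˣ) : ZMod 9) ∈ T'), g x := by
  have hinj : Set.InjOn (fun g : L ≃ₐ[ℚ] L => g • (reflexField ℚ L (algValuedIn ι Φ.1)).val)
      (reflexLift (algValuedIn ι Φ.1) (AlgHom.id ℚ L) : Set (L ≃ₐ[ℚ] L)) := by
    intro g _ g' _ h
    refine AlgEquiv.ext fun y => AlgHom.congr_fun h ⟨y, ?_⟩
    rw [reflexField_eq_top_of_key L ι Φ T hkey hΦ]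
    exact IntermediateField.mem_top
  have hset : (reflexLift (algValuedIn ι Φ.1) (AlgHom.id ℚ L) : Set (L ≃ₐ[ℚ] L)) =
      ↑(Finset.univ.filter (fun g : L ≃ₐ[ℚ] L =>
        (((IsCyclotomicExtension.zeta_spec 9 ℚ L).autToPow ℚ g : (ZMod 9)ˣ) : ZMod 9) ∈ T')) := by
    rw [Finset.coe_filter_univ]
    ext g
    rw [Set.mem_setOf_eq, mem_reflexLift_id_iff, hΦ, autToPow_symm']
    exact hT' _
  rw [reflexNorm, reflexType, finprod_mem_image hinj, hset, finprod_mem_coe_finset]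
  rfl

/-- The finite checks for `T = {1, 2, 4}`: `T⁻¹ = {1, 5, 7}`, trivial stabiliser, `1 + 5 + 7 = 13`. [folklore] -/
private theorem checks_nine :
    (∀ u : (ZMod 9)ˣ, ((u⁻¹ : (ZMod 9)ˣ) : ZMod 9) ∈ ({1, 2, 4} : Finset (ZMod 9)) ↔
      (u : ZMod 9) ∈ ({1, 5, 7} : Finset (ZMod 9))) ∧
    (∀ v : (ZMod 9)ˣ, (∀ u : (ZMod 9)ˣ, (u : ZMod 9) ∈ ({1, 2, 4} : Finset (ZMod 9)) ↔
      ((v⁻¹ * u : (ZMod 9)ˣ) : ZMod 9) ∈ ({1, 2, 4} : Finset (ZMod 9))) → v = 1) ∧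
    (∑ u ∈ Finset.univ.filter (fun u : (ZMod 9)ˣ => (u : ZMod 9) ∈ ({1, 5, 7} : Finset (ZMod 9))),
      (u : ZMod 9).val) = 13 := by
  refine ⟨by decide, by decide, by decide⟩

omit [IsCMField L] [IsGalois ℚ L] in
/-- **`K*_μ = E` at the datum**: for the CM type `Φ = {σ₁, σ₂, σ₄}` of `ℚ(ζ₉)` (through any `ι`) the reflex field presented in
`L = ℚ(ζ₉)` is all of `ℚ(ζ₉)` — in [Liu2021] Def. 4.3 (2)'s words, `M'_μ = ι(E)` for a character with `Φ_μ = Φ`.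
[cite: Shimura1998, §8.4 Example (1)] -/
theorem reflexField_nine_eq_top (ι : L →+* ℂ) (Φ : CMType L)
    (hΦ : ∀ g : L ≃ₐ[ℚ] L, ι.comp (g : L →+* L) ∈ Φ.1 ↔
      (((IsCyclotomicExtension.zeta_spec 9 ℚ L).autToPow ℚ g : (ZMod 9)ˣ) : ZMod 9) ∈ ({1, 2, 4} : Finset (ZMod 9))) :
    reflexField ℚ L (algValuedIn ι Φ.1) = ⊤ :=
  reflexField_eq_top_of_key L ι Φ _ checks_nine.2.1 hΦ

omit [IsCMField L] [IsGalois ℚ L] in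
/-- Every element of `ℚ(ζ₉)` (in particular `ζ₉`) lies in `K*` for the datum. [cite: Shimura1998, §8.4 Example (1)] -/
theorem mem_reflexField_nine (ι : L →+* ℂ) (Φ : CMType L)
    (hΦ : ∀ g : L ≃ₐ[ℚ] L, ι.comp (g : L →+* L) ∈ Φ.1 ↔
      (((IsCyclotomicExtension.zeta_spec 9 ℚ L).autToPow ℚ g : (ZMod 9)ˣ) : ZMod 9) ∈ ({1, 2, 4} : Finset (ZMod 9)))
    (x : L) : x ∈ reflexField ℚ L (algValuedIn ι Φ.1) := by
  rw [reflexField_nine_eq_top L ι Φ hΦ]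
  exact IntermediateField.mem_top

omit [IsCMField L] [IsGalois ℚ L] in
/-- **Shimura's reflex norm at the datum, on any element**: `reflexNorm(x) = σ₁(x) · σ₅(x) · σ₇(x)` — the product over the
reflex type `{σ₁, σ₅, σ₇} = {σ₁, σ₂, σ₄}⁻¹` (p308157 `comp_smul_val_mem_reflexCMType_nine_iff` identified the SET; this is the NORM).
[cite: Shimura1998, §18.5 (18.5b)] [cite: Shimura1998, §8.4 Example (1)] -/
theorem reflexNorm_nine_eq_prod (ι : L →+* ℂ) (Φ : CMType L)
    (hΦ : ∀ g : L ≃ₐ[ℚ] L, ι.comp (g : L →+* L) ∈ Φ.1 ↔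
      (((IsCyclotomicExtension.zeta_spec 9 ℚ L).autToPow ℚ g : (ZMod 9)ˣ) : ZMod 9) ∈ ({1, 2, 4} : Finset (ZMod 9)))
    (x : L) (hx : x ∈ reflexField ℚ L (algValuedIn ι Φ.1)) :
    reflexNorm ℚ L (algValuedIn ι Φ.1) (AlgHom.id ℚ L) ⟨x, hx⟩ =
      ∏ g ∈ Finset.univ.filter (fun g : L ≃ₐ[ℚ] L =>
        (((IsCyclotomicExtension.zeta_spec 9 ℚ L).autToPow ℚ g : (ZMod 9)ˣ) : ZMod 9) ∈ ({1, 5, 7} : Finset (ZMod 9))),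
        g x :=
  reflexNorm_eq_prod_of_key L ι Φ _ _ checks_nine.1 checks_nine.2.1 hΦ x hx

omit [IsCMField L] in
/-- **THE VALUE.  Shimura's `g : K* → K` ((18.5b), the reflex norm valued in `K = E`) at the datum: `g(ζ₉) = ζ₉¹·ζ₉⁵·ζ₉⁷ = ζ₉^{13} = ζ₉⁴`.**
[cite: Shimura1998, §18.5 (18.5b)] [cite: Shimura1998, §8.4 Example (1)] -/
theorem reflexNormHom_zeta_nine (ι : L →+* ℂ) (Φ : CMType L)
    (hΦ : ∀ g : L ≃ₐ[ℚ] L, ι.comp (g : L →+* L) ∈ Φ.1 ↔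
      (((IsCyclotomicExtension.zeta_spec 9 ℚ L).autToPow ℚ g : (ZMod 9)ˣ) : ZMod 9) ∈ ({1, 2, 4} : Finset (ZMod 9)))
    (hζ : IsCyclotomicExtension.zeta 9 ℚ L ∈ reflexField ℚ L (algValuedIn ι Φ.1)) :
    reflexNormHom ℚ L (algValuedIn ι Φ.1) (AlgHom.id ℚ L) ⟨IsCyclotomicExtension.zeta 9 ℚ L, hζ⟩ =
      IsCyclotomicExtension.zeta 9 ℚ L ^ 4 := by
  rw [reflexNormHom_eq_iff, reflexNorm_nine_eq_prod L ι Φ hΦ, prod_filter_autToPow_apply_zeta, checks_nine.2.2,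
    show (13 : ℕ) = 9 + 4 from rfl, pow_add, (IsCyclotomicExtension.zeta_spec 9 ℚ L).pow_eq_one, one_mul]
  rfl

/-- **In `ℂ`, over the tree's complex reflex CM type** (`Ψ_μ` through `ι` = `{ι ∘ σ₁, ι ∘ σ₅, ι ∘ σ₇}|_{K*}`, p308157):
`∏_{τ ∈ Φ*_ℂ} τ(ζ₉) = ι(ζ₉)⁴`. [cite: Shimura1998, §8.3 Prop. 29] [cite: Shimura1998, §8.4 Example (1)] -/
theorem finprod_reflexCMType_zeta_nine (ι : L →+* ℂ) (Φ : CMType L)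
    (hΦ : ∀ g : L ≃ₐ[ℚ] L, ι.comp (g : L →+* L) ∈ Φ.1 ↔
      (((IsCyclotomicExtension.zeta_spec 9 ℚ L).autToPow ℚ g : (ZMod 9)ˣ) : ZMod 9) ∈ ({1, 2, 4} : Finset (ZMod 9)))
    (hζ : IsCyclotomicExtension.zeta 9 ℚ L ∈ reflexField ℚ L (algValuedIn ι Φ.1)) :
    ∏ᶠ τ ∈ (reflexCMType ι Φ (AlgHom.id ℚ L)).1, τ ⟨IsCyclotomicExtension.zeta 9 ℚ L, hζ⟩ =
      ι (IsCyclotomicExtension.zeta 9 ℚ L) ^ 4 := by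
  rw [← comp_reflexNormHom_eq_finprod, reflexNormHom_zeta_nine L ι Φ hΦ, AlgHom.id_apply, map_pow]

/-- **[Liu2021, Def. 4.5 (1)] `η'_μ` EVALUATED.**  For every conjugate symplectic `μ` of `E = ℚ(ζ₉)` whose CM type `Φ_μ` (Def. 4.3
(2)) through `ι` is `{σ₁, σ₂, σ₄}`, the reciprocity map of Def. 4.5 (1), as typed (`Def45.etaPrime`, READING I1-R2: the type norm
of the reflex type `Ψ_μ`), takes the value `η'_μ(ζ₉) = ζ₉⁴` on `ζ₉ ∈ M'_μ = E`. [cite: Liu2021, Def. 4.5 (1) (l. 1939)]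
[cite: Shimura1998, §18.5 (18.5b)] -/
theorem etaPrime_zeta_nine (ι : L →+* ℂ) {μ : IdeleClassGroup L →ₜ* Circle}
    (hμ : IdeleClassGroup.IsConjugateSymplectic L μ)
    (hΦμ : ∀ g : L ≃ₐ[ℚ] L, ι.comp (g : L →+* L) ∈ hμ.cmType.1 ↔
      (((IsCyclotomicExtension.zeta_spec 9 ℚ L).autToPow ℚ g : (ZMod 9)ˣ) : ZMod 9) ∈ ({1, 2, 4} : Finset (ZMod 9)))
    (hζ : IsCyclotomicExtension.zeta 9 ℚ L ∈ reflexField ℚ L (algValuedIn ι hμ.cmType.1)) :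
    etaPrime (AlgHom.id ℚ L) ι hμ ⟨IsCyclotomicExtension.zeta 9 ℚ L, hζ⟩ = IsCyclotomicExtension.zeta 9 ℚ L ^ 4 := by
  rw [etaPrime_apply]
  exact reflexNormHom_zeta_nine L ι hμ.cmType hΦμ hζ

/-- **[Liu2021, Def. 4.5 (1)] `η_μ = η'_μ ∘ Nm_{M_μ/M'_μ}` EVALUATED** at `ζ₉ ∈ M'_μ ⊆ M_μ`: `η_μ(ζ₉) = η'_μ(ζ₉^{[M_μ:M'_μ]}) =
ζ₉^{4·[M_μ:M'_μ]}` (the degree `[M_μ : M'_μ]` of the field of values of `μ^{alg}` over the reflex field is not pinned by the type).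
[cite: Liu2021, Def. 4.5 (1) (l. 1941)] -/
theorem eta_incl_zeta_nine (ι : L →+* ℂ) {μ : IdeleClassGroup L →ₜ* Circle}
    (hμ : IdeleClassGroup.IsConjugateSymplectic L μ)
    (hΦμ : ∀ g : L ≃ₐ[ℚ] L, ι.comp (g : L →+* L) ∈ hμ.cmType.1 ↔
      (((IsCyclotomicExtension.zeta_spec 9 ℚ L).autToPow ℚ g : (ZMod 9)ˣ) : ZMod 9) ∈ ({1, 2, 4} : Finset (ZMod 9)))
    (hζ : IsCyclotomicExtension.zeta 9 ℚ L ∈ reflexField ℚ L (algValuedIn ι hμ.cmType.1)) :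
    eta (AlgHom.id ℚ L) ι hμ (incl (AlgHom.id ℚ L) ι hμ ⟨IsCyclotomicExtension.zeta 9 ℚ L, hζ⟩) =
      IsCyclotomicExtension.zeta 9 ℚ L ^
        (4 * (letI := (incl (AlgHom.id ℚ L) ι hμ).toAlgebra
          Module.finrank (reflexField ℚ L (algValuedIn ι hμ.cmType.1)) (IdeleClassGroup.muAlgValueField L μ))) := by
  letI := (incl (AlgHom.id ℚ L) ι hμ).toAlgebra
  rw [eta_apply]
  change etaPrime (AlgHom.id ℚ L) ι hμ (Algebra.norm (reflexField ℚ L (algValuedIn ι hμ.cmType.1))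
    (algebraMap (reflexField ℚ L (algValuedIn ι hμ.cmType.1)) (IdeleClassGroup.muAlgValueField L μ)
      ⟨IsCyclotomicExtension.zeta 9 ℚ L, hζ⟩)) = _
  rw [Algebra.norm_algebraMap, map_pow, etaPrime_zeta_nine L ι hμ hΦμ hζ, ← pow_mul]

/-- **The first bullet of Def. 4.5 (2) at the datum** (the cotangent side of TGTBT D11.3 item 5): for any CM datum `D_μ` for such a
`μ` (an inhabitant is [Liu2021] Prop. 4.6 (1), NOT in the tree — `D` is a hypothesis) and any `f ∈ End_E(A_μ)` with `i_μ(ζ₉) = 1 ⊗ f`,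
`det(f^* | 𝔪_e/𝔪_e²) = η_μ(ζ₉) = ζ₉^{4·[M_μ:M'_μ]}` in `E = ℚ(ζ₉)`. [cite: Liu2021, Def. 4.5 (2) (l. 1950)] -/
theorem det_cotangentMap_zeta_nine (ι : L →+* ℂ) {μ : IdeleClassGroup L →ₜ* Circle}
    (hμ : IdeleClassGroup.IsConjugateSymplectic L μ)
    (hΦμ : ∀ g : L ≃ₐ[ℚ] L, ι.comp (g : L →+* L) ∈ hμ.cmType.1 ↔
      (((IsCyclotomicExtension.zeta_spec 9 ℚ L).autToPow ℚ g : (ZMod 9)ˣ) : ZMod 9) ∈ ({1, 2, 4} : Finset (ZMod 9)))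
    (hζ : IsCyclotomicExtension.zeta 9 ℚ L ∈ reflexField ℚ L (algValuedIn ι hμ.cmType.1))
    {hw : IdeleClassGroup.HasWeight L μ 1} {C : Carriers L μ} (D : CMDatum (AlgHom.id ℚ L) ι hμ hw C)
    {f : CategoryTheory.End D.A}
    (h : D.i (incl (AlgHom.id ℚ L) ι hμ ⟨IsCyclotomicExtension.zeta 9 ℚ L, hζ⟩) = AbelianVariety.endAlgebra.of D.A f) :
    LinearMap.det (AbelianVariety.cotangentMap D.A f) =
      IsCyclotomicExtension.zeta 9 ℚ L ^
        (4 * (letI := (incl (AlgHom.id ℚ L) ι hμ).toAlgebra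
          Module.finrank (reflexField ℚ L (algValuedIn ι hμ.cmType.1)) (IdeleClassGroup.muAlgValueField L μ))) := by
  rw [D.det_cotangentMap_eq_eta h, eta_incl_zeta_nine L ι hμ hΦμ hζ]

/-- **THE TOY CM DATUM EXISTS IN THE TREE, AND `η'_μ(ζ₉) = ζ₉⁴` AT IT.**  For every presentation `ι : ℚ(ζ₉) → ℂ` there is a
conjugate symplectic automorphic character `μ` of `𝔸_E^×`, `E = ℚ(ζ₉)`, of weight one (tree theorem
`exists_isConjugateSymplectic_hasCMType`, [WeilBNT1967] Ch. VII §3) with `Φ_μ = {σ₁, σ₂, σ₄}` through `ι`; for it `M'_μ = E`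
(`K*_μ = ⊤`) and `η'_μ(ζ₉) = ζ₉⁴`. [cite: Liu2021, Def. 4.3 (2) (l. 1919) and Def. 4.5 (1) (l. 1939)] [cite: Shimura1998, §8.4 Example (1)] -/
theorem exists_toyDatum_nine (ι : L →+* ℂ) :
    ∃ (μ : IdeleClassGroup L →ₜ* Circle) (hμ : IdeleClassGroup.IsConjugateSymplectic L μ),
      IdeleClassGroup.HasWeight L μ 1 ∧
      (∀ g : L ≃ₐ[ℚ] L, ι.comp (g : L →+* L) ∈ hμ.cmType.1 ↔
        (((IsCyclotomicExtension.zeta_spec 9 ℚ L).autToPow ℚ g : (ZMod 9)ˣ) : ZMod 9) ∈ ({1, 2, 4} : Finset (ZMod 9))) ∧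
      reflexField ℚ L (algValuedIn ι hμ.cmType.1) = ⊤ ∧
      ∃ hζ : IsCyclotomicExtension.zeta 9 ℚ L ∈ reflexField ℚ L (algValuedIn ι hμ.cmType.1),
        etaPrime (AlgHom.id ℚ L) ι hμ ⟨IsCyclotomicExtension.zeta 9 ℚ L, hζ⟩ = IsCyclotomicExtension.zeta 9 ℚ L ^ 4 := by
  obtain ⟨Φ, hΦ⟩ := exists_cmType_nine L ι
  obtain ⟨μ, hμ, hw, hμΦ⟩ := IdeleClassGroup.exists_isConjugateSymplectic_hasCMType Φ
  obtain rfl : hμ.cmType = Φ := hμ.cmType_eq hμΦ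
  exact ⟨μ, hμ, hw, hΦ, reflexField_nine_eq_top L ι _ hΦ, mem_reflexField_nine L ι _ hΦ _,
    etaPrime_zeta_nine L ι hμ hΦ _⟩

omit [IsCMField L] [IsGalois ℚ L] in
/-- The type norms at `ζ₉` of the three RIVAL candidate types, Galois side: `N_{{1,2,4}}(ζ₉) = ζ₉⁷` (`Φ` itself), `N_{{5,7,8}}(ζ₉) = ζ₉²`
(`Φ̄`), `N_{{2,4,8}}(ζ₉) = ζ₉⁵` (`Φ̄* = Φ̄⁻¹`, the conjugate convention `η̄'`); the tree's `η'` is `N_{{1,5,7}}(ζ₉) = ζ₉⁴`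
(`reflexNorm_nine_eq_prod` + `reflexNorm_zeta_nine`). [cite: Shimura1998, §8.4 Example (1)] -/
theorem prod_rival_conventions_zeta_nine :
    (∏ g ∈ Finset.univ.filter (fun g : L ≃ₐ[ℚ] L =>
        (((IsCyclotomicExtension.zeta_spec 9 ℚ L).autToPow ℚ g : (ZMod 9)ˣ) : ZMod 9) ∈ ({1, 2, 4} : Finset (ZMod 9))),
      g (IsCyclotomicExtension.zeta 9 ℚ L) = IsCyclotomicExtension.zeta 9 ℚ L ^ 7) ∧
    (∏ g ∈ Finset.univ.filter (fun g : L ≃ₐ[ℚ] L =>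
        (((IsCyclotomicExtension.zeta_spec 9 ℚ L).autToPow ℚ g : (ZMod 9)ˣ) : ZMod 9) ∈ ({5, 7, 8} : Finset (ZMod 9))),
      g (IsCyclotomicExtension.zeta 9 ℚ L) = IsCyclotomicExtension.zeta 9 ℚ L ^ 2) ∧
    (∏ g ∈ Finset.univ.filter (fun g : L ≃ₐ[ℚ] L =>
        (((IsCyclotomicExtension.zeta_spec 9 ℚ L).autToPow ℚ g : (ZMod 9)ˣ) : ZMod 9) ∈ ({2, 4, 8} : Finset (ZMod 9))),
      g (IsCyclotomicExtension.zeta 9 ℚ L) = IsCyclotomicExtension.zeta 9 ℚ L ^ 5) := by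
  have h9 := (IsCyclotomicExtension.zeta_spec 9 ℚ L).pow_eq_one
  have e1 : (∑ u ∈ Finset.univ.filter (fun u : (ZMod 9)ˣ => (u : ZMod 9) ∈ ({1, 2, 4} : Finset (ZMod 9))),
      (u : ZMod 9).val) = 7 := by decide
  have e3 : (∑ u ∈ Finset.univ.filter (fun u : (ZMod 9)ˣ => (u : ZMod 9) ∈ ({5, 7, 8} : Finset (ZMod 9))),
      (u : ZMod 9).val) = 9 + 9 + 2 := by decide
  have e4 : (∑ u ∈ Finset.univ.filter (fun u : (ZMod 9)ˣ => (u : ZMod 9) ∈ ({2, 4, 8} : Finset (ZMod 9))),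
      (u : ZMod 9).val) = 9 + 5 := by decide
  refine ⟨?_, ?_, ?_⟩ <;> rw [prod_filter_autToPow_apply_zeta]
  · rw [e1]
  · rw [e3, pow_add, pow_add, h9, one_mul, one_mul]
  · rw [e4, pow_add, h9, one_mul]

omit [IsCMField L] [IsGalois ℚ L] in
/-- `ζ₉⁴`, `ζ₉⁷`, `ζ₉²`, `ζ₉⁵` are pairwise distinct (`ζ₉` has order `9`): at this datum a slip between `η' = N_{Φ*}` and any of
`N_Φ`, `N_Φ̄`, `N_{Φ̄*} = η̄'` in the VALUE of the reciprocity map is detected. [cite: Shimura1998, §8.4 Example (1)] -/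
theorem zeta_pow_rival_pairwise_ne :
    IsCyclotomicExtension.zeta 9 ℚ L ^ 4 ≠ IsCyclotomicExtension.zeta 9 ℚ L ^ 7 ∧
    IsCyclotomicExtension.zeta 9 ℚ L ^ 4 ≠ IsCyclotomicExtension.zeta 9 ℚ L ^ 2 ∧
    IsCyclotomicExtension.zeta 9 ℚ L ^ 4 ≠ IsCyclotomicExtension.zeta 9 ℚ L ^ 5 ∧
    IsCyclotomicExtension.zeta 9 ℚ L ^ 7 ≠ IsCyclotomicExtension.zeta 9 ℚ L ^ 2 ∧
    IsCyclotomicExtension.zeta 9 ℚ L ^ 7 ≠ IsCyclotomicExtension.zeta 9 ℚ L ^ 5 ∧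
    IsCyclotomicExtension.zeta 9 ℚ L ^ 2 ≠ IsCyclotomicExtension.zeta 9 ℚ L ^ 5 := by
  have hζ := IsCyclotomicExtension.zeta_spec 9 ℚ L
  refine ⟨fun h => ?_, fun h => ?_, fun h => ?_, fun h => ?_, fun h => ?_, fun h => ?_⟩ <;> exact absurd (hζ.pow_inj (by norm_num) (by norm_num) h) (by norm_num)

omit [IsCMField L] in
/-- **The conjugate type's reflex norm at the datum is the conjugate value**: for `Φ̄ = {σ₅, σ₇, σ₈}` (reflex type `{σ₂, σ₄, σ₈}`,
p308157 `comp_smul_val_mem_reflexCMType_bar_nine_iff`), `g_{Φ̄}(ζ₉) = ζ₉^{14} = ζ₉⁵ = ζ₉^{-4}` — [Liu2021] Rem. 4.4 «`Ψ_{μ^c}` is the opposite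
CM type of `Ψ_μ`»: the conjugate convention is `η'_{μ^c}`, not a second reading of `η'_μ`. [cite: Shimura1998, §18.5 (18.5b)]
[cite: Liu2021, Remark 4.4 (l. 1930)] -/
theorem reflexNormHom_bar_zeta_nine (ι : L →+* ℂ) (Φ : CMType L)
    (hΦ : ∀ g : L ≃ₐ[ℚ] L, ι.comp (g : L →+* L) ∈ Φ.1 ↔
      (((IsCyclotomicExtension.zeta_spec 9 ℚ L).autToPow ℚ g : (ZMod 9)ˣ) : ZMod 9) ∈ ({1, 2, 4} : Finset (ZMod 9)))
    (hζ : IsCyclotomicExtension.zeta 9 ℚ L ∈ reflexField ℚ L (algValuedIn ι (CMTypeOps.bar Φ).1)) :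
    reflexNormHom ℚ L (algValuedIn ι (CMTypeOps.bar Φ).1) (AlgHom.id ℚ L) ⟨IsCyclotomicExtension.zeta 9 ℚ L, hζ⟩ =
      IsCyclotomicExtension.zeta 9 ℚ L ^ 5 := by
  have hbar := comp_mem_bar_nine_iff L ι Φ hΦ
  have hT' : ∀ u : (ZMod 9)ˣ, ((u⁻¹ : (ZMod 9)ˣ) : ZMod 9) ∈ ({5, 7, 8} : Finset (ZMod 9)) ↔
      (u : ZMod 9) ∈ ({2, 4, 8} : Finset (ZMod 9)) := by decide
  have hkey : ∀ v : (ZMod 9)ˣ, (∀ u : (ZMod 9)ˣ, (u : ZMod 9) ∈ ({5, 7, 8} : Finset (ZMod 9)) ↔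
      ((v⁻¹ * u : (ZMod 9)ˣ) : ZMod 9) ∈ ({5, 7, 8} : Finset (ZMod 9))) → v = 1 := by decide
  have hsum : (∑ u ∈ Finset.univ.filter (fun u : (ZMod 9)ˣ => (u : ZMod 9) ∈ ({2, 4, 8} : Finset (ZMod 9))),
      (u : ZMod 9).val) = 9 + 5 := by decide
  rw [reflexNormHom_eq_iff, reflexNorm_eq_prod_of_key L ι (CMTypeOps.bar Φ) _ _ hT' hkey hbar, prod_filter_autToPow_apply_zeta,
    hsum, pow_add, (IsCyclotomicExtension.zeta_spec 9 ℚ L).pow_eq_one, one_mul]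
  rfl

/-- … and `ζ₉⁵` IS the complex conjugate of the datum's value `ζ₉⁴` inside the CM field `ℚ(ζ₉)` (`ρ ζ₉ = ζ₉⁻¹ = ζ₉⁸`):
`η̄'(ζ₉) = ρ(η'(ζ₉))`. [cite: Shimura1998, §18.5 (18.5c)] -/
theorem complexConj_zeta_pow_four :
    IsCMField.complexConj L (IsCyclotomicExtension.zeta 9 ℚ L ^ 4) = IsCyclotomicExtension.zeta 9 ℚ L ^ 5 := by
  have hζ := IsCyclotomicExtension.zeta_spec 9 ℚ L
  have h := hζ.autToPow_spec ℚ (conjGal : L ≃ₐ[ℚ] L)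
  rw [autToPow_conjGal_nine L] at h
  have hval : (((-1 : (ZMod 9)ˣ) : ZMod 9)).val = 8 := by decide
  rw [hval, conjGal_apply] at h
  rw [map_pow, ← h, ← pow_mul, show (8 * 4 : ℕ) = 9 * 3 + 5 from rfl, pow_add, pow_mul, hζ.pow_eq_one, one_pow,
    one_mul]

end Nine

end Def45

end Literature.NumberTheory.Automorphic.Liu2021

end
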